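/-
Copyright (c) 2026 the pub-hodgecm-mathlib formalisation cell (harness21).  Prover seat hodgecm-mathlib-K2E3-p23 (g3), Track B «K2-LIT» ∕ h413
(`stmt-HodgeConjecture-24833`), line `K2_E3_EllipticInputs`, 13a road A (line lead K2E3-p10 (g3)), item (D3) «Witt–Cartan, K₀-group currency, normalised
kernel», file G3b.  2026-09-04.
-/
import Summits.HodgeConjecture.HodgeConjecture.Theorems.K2E3WittCartanTerminate   -- G3a (this seat): one-sided pivot, kernel-block integrality, termination; brings G1, G2, ★ F1–F3
import HarnessLib

/-!
# Crux `H413` — K2-LIT E3 «EllipticInputs», 13a road A, item (D3) G3: THE CARTAN DECOMPOSITION `U(σ, W)(K) = K₀ · T · K₀` for a Witt form `W = wittFormOn e Han`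
# with a NORMALISED anisotropic kernel of any size `m` — the letter `hrawW` of the line lead (sorted exponents, `d ≡ 1` on the kernel)

Cell `hodgecm-mathlib`, Track B «K2-LIT», crux item `stmt-HodgeConjecture-24833` (h413), socket U12-g ‹13a› road A.  Item (D3) of RULINGS #13 (K2 bus 2026-09-04T02:16:29Z;
letter fixed 02:22:20Z): for `σ` an involution preserving `v`, a uniformiser `ϖ`, a standard indexing `e`, and `Han` hermitian, integral, normalised (`|h_an(z,z)| ≤ 1 → z ∈
𝒪^m`, ★ p856519), every `g ∈ U(σ, wittFormOn e Han)` is `k₁⁻¹ · diag(d) · k₂⁻¹` with `k₁, k₂ ∈ K₀ = U ∩ GL_N(𝒪)`, `σ(d_a) d_{rev a} = 1`, `d ≡ 1` on the kernel positions,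
`|d_a| = q^{−E_a}` with `E` ANTITONE along `Fin N`.  This is the `hrawW` binder of ★ p856772 `K2E3WittLeviCartanRecursionKernel.exists_leviIntegral_mul_diagonalGL_mul_kernel`
(K2E3-p10), the last letter of the 13a road at the non-quasi-split (`m = 2`) places.

THE PROOF is a frame induction INSIDE `U(σ, W)`: at stage `k ≤ r` the element `q = k₁ g k₂` has `e_a`, `f_a` (`a < k`) as eigenvectors with eigenvalues of valuation
`≤ B⁻¹ ≤ 1` on the `e`-side, sorted increasingly, and its entries and those of `q⁻¹` on the frame `S_k × S_k` are bounded by `B`.  If the `S_k`-block of `q` and `q⁻¹` is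
integral (always the case at `k = r`: the kernel block lies in `U(Han) ⊆ GL_m(𝒪)` by the normalisation) then `k₃ = q⁻¹ · diag(d) ∈ K₀` finishes (§2); otherwise the
maximum `M > 1` over `S_k × S_k` is attained at a hyperbolic pivot (★ G1) and the elimination step (★ G2) produces the next eigen-pair with `|c_k| = M⁻¹ ≥ B⁻¹` (§3).

* **`exists_cartan_of_invariant`** — the induction (pivot ★ G3a `exists_pivot_witt`, step ★ G2 `exists_conj_eigen_of_pivot_witt`, termination ★ G3a
  `exists_cartan_of_integral_frame` ∕ `frame_r_integral`); **`exists_cartan_witt`** — THE LETTER `hrawW`, token for token.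

`--supports stmt-HodgeConjecture-24833 --as helper`.  THEOREMS ONLY — no `def`, no named fact, no instance, no notation, no `sorry`.  HONEST LABEL: HC_CM is
proved only modulo the 7 printed citations (2 remaining named inputs: hLiu418 = stmt-HodgeConjecture-24832, h413 = stmt-HodgeConjecture-24833) until rung 0
closes; unconditional local algebra, closes no organ by itself.

References: [BruhatTits1972] F. Bruhat, J. Tits, Publ. Math. IHÉS 41 (1972), (4.4.3) (`G = K Λ⁺ K` for a good maximal compact `K`) · [Tits1979] J. Tits, PSPM 33.1
(1979), §3.3.3 · [Macdonald1995] I. G. Macdonald (1995), Ch. V §2 · [Jacobowitz1962] R. Jacobowitz, Amer. J. Math. 84 (1962), §§4, 7–10 · [Omeara1963] O. T.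
O'Meara (1963), §91A.
-/

set_option autoImplicit false
-- the mandated namespace repeats `HodgeConjecture.HodgeConjecture`, as in every `Theorems/*.lean` of this sub-problem
set_option linter.dupNamespace false

noncomputable section

open scoped Matrix MatrixGroups Valued WithZero
open Matrix

namespace Summit.HodgeConjecture.HodgeConjecture.Cruxes.H413.K2E3WittCartan

open Literature.NumberTheory.Automorphic Literature.NumberTheory.Automorphic.UnitaryGroup Literature.NumberTheory.Automorphic.HermitianLattice
open K2E3LocalUnitaryWitt K2E3WittCartanUnramified K2E3WittParabolicBlocks K2E3WittHermFormStd K2E3WittIntegralMoves K2E3WittIntegralTransitive K2E3WittIwasawa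
  K2E3WittCartanPivot K2E3WittCartanStep K2E3WittCartanTerminate

variable {K : Type*} [Field K] [Valued K ℤᵐ⁰] (σ : K →+* K) {N r m : ℕ} (e : WittIndex r m ≃ Fin N)
  (hstd : ∀ x, (e x).val = Sum.elim (fun i : Fin r => i.val) (Sum.elim (fun u : Fin m => r + u.val) (fun j : Fin r => r + m + j.val)) x)
  (Han : Matrix (Fin m) (Fin m) K)

/-! ## The frame induction and the letter `hrawW` -/

section Main

include hstd in
/-- **THE FRAME INDUCTION.**  Invariant at stage `k` (`k + n = r`, bound `B ≥ 1`): every `e_a`, `a ∉ S_k`, is an eigenvector of `q` (eigenvalue `q_{aa}`); on the positions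
`a < k` the eigenvalues satisfy `|q_{aa}| ≤ B⁻¹` and are sorted increasingly; the `S_k × S_k` entries of `q`, `q⁻¹` are bounded by `B`.  Conclusion: `k₁ q k₂ = diag(d)` as in
the letter.  If the `S_k`-block is integral, ★ §2 terminates (at `k = r` this is automatic, `frame_r_integral`); otherwise the maximum `M > 1` on `S_k × S_k` is a
hyperbolic pivot (`exists_pivot_witt`), ★ G2 produces the eigen-pair at `k`, `rev k` with `|q′_{kk}| = M⁻¹ ∈ [B⁻¹, 1)` and bound `M` on `S_{k+1}`, and the induction
hypothesis applies. [cite: BruhatTits1972, (4.4.3)] [cite: Tits1979, §3.3.3] [cite: Macdonald1995, Ch. V §2] -/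
theorem exists_cartan_of_invariant (hσ : ∀ a, σ (σ a) = a) (hvσ : ∀ a, Valued.v (σ a) = Valued.v a) {ϖ : K} (hϖ : Valued.v ϖ = WithZero.exp (-1 : ℤ))
    (hHan : (Han.map σ)ᵀ = Han) (hint : ∀ u u', Valued.v (Han u u') ≤ 1) (hmax : ∀ z : Fin m → K, Valued.v (hermForm σ Han z z) ≤ 1 → z ∈ stdLattice K m) :
    ∀ (n k : ℕ), k + n = r → ∀ (B : ℤᵐ⁰) (q : unitaryGroupOfForm σ (wittFormOn e Han)), 1 ≤ B →
      (∀ a : Fin N, a ∉ (Finset.univ.filter fun a : Fin N => k ≤ a.val ∧ a.val + k < N) →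
        ((q : GL (Fin N) K) : Matrix (Fin N) (Fin N) K) *ᵥ Pi.single a 1 = ((q : GL (Fin N) K) : Matrix (Fin N) (Fin N) K) a a • Pi.single a 1) →
      (∀ a : Fin N, a.val < k → Valued.v (((q : GL (Fin N) K) : Matrix (Fin N) (Fin N) K) a a) ≤ B⁻¹) →
      (∀ a b : Fin N, a.val < k → b.val < k → a ≤ b →
        Valued.v (((q : GL (Fin N) K) : Matrix (Fin N) (Fin N) K) a a) ≤ Valued.v (((q : GL (Fin N) K) : Matrix (Fin N) (Fin N) K) b b)) →
      (∀ a ∈ (Finset.univ.filter fun a : Fin N => k ≤ a.val ∧ a.val + k < N), ∀ b ∈ (Finset.univ.filter fun a : Fin N => k ≤ a.val ∧ a.val + k < N),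
        Valued.v (((q : GL (Fin N) K) : Matrix (Fin N) (Fin N) K) a b) ≤ B ∧ Valued.v ((((q : GL (Fin N) K)⁻¹ : GL (Fin N) K) : Matrix (Fin N) (Fin N) K) a b) ≤ B) →
      ∃ k₁ k₂ : unitaryGroupOfForm σ (wittFormOn e Han), k₁ ∈ unitaryInt σ (wittFormOn e Han) ∧ k₂ ∈ unitaryInt σ (wittFormOn e Han) ∧
        ∃ (d : Fin N → K) (E : Fin N → ℤ), (((k₁ * q * k₂ : unitaryGroupOfForm σ (wittFormOn e Han)) : GL (Fin N) K) : Matrix (Fin N) (Fin N) K) = Matrix.diagonal d ∧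
          (∀ i, σ (d i) * d (Fin.rev i) = 1) ∧ (∀ u : Fin m, d (e (Sum.inr (Sum.inl u))) = 1) ∧ (∀ a, Valued.v (d a) = WithZero.exp (-E a)) ∧
          (∀ a b : Fin N, a ≤ b → E b ≤ E a) := by
  have hN : N = r + (m + r) := card_eq e
  intro n
  induction n with
  | zero =>
    intro k hk B q hB heig hsmall hsort _
    have hkr : k = r := by omega
    subst hkr
    obtain ⟨k₂, hk₂, d, E, hdiag, htor, hker, hexp, hanti⟩ := exists_cartan_of_integral_frame σ e hstd Han hvσ le_rfl q heig
      (fun a ha => (hsmall a ha).trans (inv_le_one_of_one_le₀ hB)) hsort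
      (frame_r_integral σ e hstd Han hint hmax q fun a ha => ⟨_, heig a ha⟩)
    exact ⟨1, k₂, (unitaryInt σ _).one_mem, hk₂, d, E, by rw [one_mul]; exact hdiag, htor, hker, hexp, hanti⟩
  | succ n ih =>
    intro k hk B q hB heig hsmall hsort hle
    have hkr : k < r := by omega
    set S : Finset (Fin N) := Finset.univ.filter fun a : Fin N => k ≤ a.val ∧ a.val + k < N with hSdef
    by_cases hintS : ∀ a ∈ S, ∀ b ∈ S, Valued.v (((q : GL (Fin N) K) : Matrix (Fin N) (Fin N) K) a b) ≤ 1 ∧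
        Valued.v ((((q : GL (Fin N) K)⁻¹ : GL (Fin N) K) : Matrix (Fin N) (Fin N) K) a b) ≤ 1
    · -- termination
      obtain ⟨k₂, hk₂, d, E, hdiag, htor, hker, hexp, hanti⟩ := exists_cartan_of_integral_frame σ e hstd Han hvσ hkr.le q heig
        (fun a ha => (hsmall a ha).trans (inv_le_one_of_one_le₀ hB)) hsort hintS
      exact ⟨1, k₂, (unitaryInt σ _).one_mem, hk₂, d, E, by rw [one_mul]; exact hdiag, htor, hker, hexp, hanti⟩
    · -- a maximal entry `M > 1` on `S × S`
      push Not at hintS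
      obtain ⟨a₀, ha₀, b₀, hb₀, hab₀⟩ := hintS
      have hne : (S ×ˢ S).Nonempty := ⟨(a₀, b₀), Finset.mem_product.2 ⟨ha₀, hb₀⟩⟩
      obtain ⟨⟨a₁, b₁⟩, hab₁, hmaxf⟩ := Finset.exists_max_image (S ×ˢ S)
        (fun ab : Fin N × Fin N => max (Valued.v (((q : GL (Fin N) K) : Matrix (Fin N) (Fin N) K) ab.1 ab.2))
          (Valued.v ((((q : GL (Fin N) K)⁻¹ : GL (Fin N) K) : Matrix (Fin N) (Fin N) K) ab.1 ab.2))) hne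
      obtain ⟨ha₁, hb₁⟩ := Finset.mem_product.1 hab₁
      set M : ℤᵐ⁰ := max (Valued.v (((q : GL (Fin N) K) : Matrix (Fin N) (Fin N) K) a₁ b₁))
        (Valued.v ((((q : GL (Fin N) K)⁻¹ : GL (Fin N) K) : Matrix (Fin N) (Fin N) K) a₁ b₁)) with hMdef
      have hleM : ∀ a ∈ S, ∀ b ∈ S, Valued.v (((q : GL (Fin N) K) : Matrix (Fin N) (Fin N) K) a b) ≤ M ∧
          Valued.v ((((q : GL (Fin N) K)⁻¹ : GL (Fin N) K) : Matrix (Fin N) (Fin N) K) a b) ≤ M := fun a ha b hb => by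
        have h := hmaxf (a, b) (Finset.mem_product.2 ⟨ha, hb⟩)
        exact ⟨(le_max_left _ _).trans h, (le_max_right _ _).trans h⟩
      have hM1 : 1 < M := by
        have h := hleM a₀ ha₀ b₀ hb₀
        by_contra hM
        rw [not_lt] at hM
        exact absurd (hab₀ (h.1.trans hM)) (not_lt.2 (h.2.trans hM))
      have hM0 : M ≠ 0 := ne_of_gt (lt_trans zero_lt_one hM1)
      have hMB : M ≤ B := by
        rcases max_choice (Valued.v (((q : GL (Fin N) K) : Matrix (Fin N) (Fin N) K) a₁ b₁))
          (Valued.v ((((q : GL (Fin N) K)⁻¹ : GL (Fin N) K) : Matrix (Fin N) (Fin N) K) a₁ b₁)) with h | h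
        · rw [hMdef, h]; exact (hle a₁ ha₁ b₁ hb₁).1
        · rw [hMdef, h]; exact (hle a₁ ha₁ b₁ hb₁).2
      -- frame data
      have hS : ∀ i ∈ S, Fin.rev i ∈ S := rev_mem_frameSet k
      have hSc : ∀ a : Fin N, a ∉ S → (a.val < r ∨ r + m ≤ a.val) := hyperbolic_of_not_mem_frameSet e hkr.le
      have hSk : ∀ a : Fin N, r ≤ a.val → a.val < r + m → a ∈ S := kernel_mem_frameSet e hkr.le
      have heig' : ∀ a : Fin N, a ∉ S → ∃ c : K, ((q : GL (Fin N) K) : Matrix (Fin N) (Fin N) K) *ᵥ Pi.single a 1 = c • Pi.single a 1 := fun a ha => ⟨_, heig a ha⟩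
      have hqS : ∀ b ∈ S, ((q : GL (Fin N) K) : Matrix (Fin N) (Fin N) K) *ᵥ Pi.single b 1 ∈ frame K N S := fun b hb =>
        mulVec_mem_frame_of_eigen σ e hstd Han q hS hSc heig' (single_mem_frame hb)
      have hqiS : ∀ b ∈ S, (((q : GL (Fin N) K)⁻¹ : GL (Fin N) K) : Matrix (Fin N) (Fin N) K) *ᵥ Pi.single b 1 ∈ frame K N S := fun b hb => by
        have h := mulVec_mem_frame_of_eigen σ e hstd Han q⁻¹ hS hSc (fun a ha => by
          obtain ⟨c, hc⟩ := heig' a ha; rw [Subgroup.coe_inv]; exact ⟨c⁻¹, inv_mulVec_single_of_eigen σ q hc⟩) (single_mem_frame hb)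
        rwa [Subgroup.coe_inv] at h
      -- the pivot, for `q` itself
      have hab : Valued.v (((q : GL (Fin N) K) : Matrix (Fin N) (Fin N) K) a₁ b₁) = M ∨
          Valued.v ((((q : GL (Fin N) K)⁻¹ : GL (Fin N) K) : Matrix (Fin N) (Fin N) K) a₁ b₁) = M := by
        rcases max_choice (Valued.v (((q : GL (Fin N) K) : Matrix (Fin N) (Fin N) K) a₁ b₁))
          (Valued.v ((((q : GL (Fin N) K)⁻¹ : GL (Fin N) K) : Matrix (Fin N) (Fin N) K) a₁ b₁)) with h | h
        · exact Or.inl (by rw [hMdef, h])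
        · exact Or.inr (by rw [hMdef, h])
      obtain ⟨s, hsS, t, htS, hs, ht, hst⟩ := exists_pivot_witt σ e hstd Han hvσ hϖ hint hmax q hS hSk hqS hqiS hM1 hleM hb₁ hab
      -- the elimination step
      obtain ⟨k₁, k₂, hk₁, hk₂, hfix, hp, hrp, hle'⟩ := exists_conj_eigen_of_pivot_witt σ e hstd Han hσ hvσ hHan hint hkr q heig' hM0 hleM hsS htS hs ht hst
      set q' : unitaryGroupOfForm σ (wittFormOn e Han) := k₁ * q * k₂ with hq'
      set p : Fin N := ⟨k, by omega⟩ with hpdef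
      have hc_new : Valued.v ((σ (((q : GL (Fin N) K) : Matrix (Fin N) (Fin N) K) s t))⁻¹) = M⁻¹ := by rw [map_inv₀, hvσ, hst]
      -- the eigen-structure of `q′` off `S_{k+1}`
      have hcol_old : ∀ a : Fin N, a ∉ S → ((q' : GL (Fin N) K) : Matrix (Fin N) (Fin N) K) *ᵥ Pi.single a 1 =
          ((q : GL (Fin N) K) : Matrix (Fin N) (Fin N) K) a a • Pi.single a 1 := fun a ha => by
        rw [hq', mul_mulVec, mul_mulVec, (hfix a ha).2, heig a ha, Matrix.mulVec_smul, (hfix a ha).1]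
      have hdiag_of : ∀ {Q : Matrix (Fin N) (Fin N) K} {a : Fin N} {c : K}, Q *ᵥ Pi.single a 1 = c • Pi.single a 1 → Q a a = c := fun {Q a c} h => by
        rw [apply_eq_mulVec_single Q a a, h, Pi.smul_apply, Pi.single_eq_same, smul_eq_mul, mul_one]
      have hq'old : ∀ a : Fin N, a ∉ S → ((q' : GL (Fin N) K) : Matrix (Fin N) (Fin N) K) a a = ((q : GL (Fin N) K) : Matrix (Fin N) (Fin N) K) a a :=
        fun a ha => hdiag_of (hcol_old a ha)
      have hq'p : ((q' : GL (Fin N) K) : Matrix (Fin N) (Fin N) K) p p = (σ (((q : GL (Fin N) K) : Matrix (Fin N) (Fin N) K) s t))⁻¹ := hdiag_of hp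
      have hq'rp : ((q' : GL (Fin N) K) : Matrix (Fin N) (Fin N) K) (Fin.rev p) (Fin.rev p) = ((q : GL (Fin N) K) : Matrix (Fin N) (Fin N) K) s t := hdiag_of hrp
      have hlowS : ∀ a : Fin N, a.val < k → a ∉ S := fun a ha h => by rw [hSdef, mem_frameSet_iff] at h; omega
      have hBM : B⁻¹ ≤ M⁻¹ := inv_anti₀ (zero_lt_iff.2 hM0) hMB
      -- apply the induction hypothesis at stage `k + 1` with bound `M`
      obtain ⟨k₁', k₂', hk₁', hk₂', d, E, hdiag, htor, hker, hexp, hanti⟩ := ih (k + 1) (by omega) M q' hM1.le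
        (fun a ha => by
          by_cases haS : a ∈ S
          · rcases eq_or_eq_of_mem_frameSet_of_not_mem_succ a haS ha (by omega) with rfl | rfl
            · rw [hp, hq'p]
            · rw [hrp, hq'rp]
          · rw [hcol_old a haS, hq'old a haS])
        (fun a ha => by
          rcases Nat.lt_or_ge a.val k with ha' | ha'
          · rw [hq'old a (hlowS a ha')]; exact (hsmall a ha').trans hBM
          · have hap : a = p := Fin.ext (by rw [hpdef]; dsimp only; omega)
            rw [hap, hq'p, hc_new])
        (fun a b ha hb hab => by
          rcases Nat.lt_or_ge b.val k with hb' | hb'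
          · have ha' : a.val < k := lt_of_le_of_lt (Fin.le_def.1 hab) hb'
            rw [hq'old a (hlowS a ha'), hq'old b (hlowS b hb')]; exact hsort a b ha' hb' hab
          · have hbp : b = p := Fin.ext (by rw [hpdef]; dsimp only; omega)
            rcases Nat.lt_or_ge a.val k with ha' | ha'
            · rw [hq'old a (hlowS a ha'), hbp, hq'p, hc_new]; exact (hsmall a ha').trans hBM
            · have hap : a = p := Fin.ext (by rw [hpdef]; dsimp only; omega)
              rw [hap, hbp])
        (fun a ha b hb => hle' a (frameSet_succ_subset k ha) b (frameSet_succ_subset k hb))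
      refine ⟨k₁' * k₁, k₂ * k₂', (unitaryInt σ _).mul_mem hk₁' hk₁, (unitaryInt σ _).mul_mem hk₂ hk₂', d, E, ?_, htor, hker, hexp, hanti⟩
      rw [← hdiag, hq']
      congr 2
      group

include hstd in
/-- **THE CARTAN DECOMPOSITION `U(σ, W)(K) = K₀ · T · K₀` FOR A WITT FORM WITH A NORMALISED ANISOTROPIC KERNEL OF ANY SIZE — the letter `hrawW`** of ★ p856772
`K2E3WittLeviCartanRecursionKernel.exists_leviIntegral_mul_diagonalGL_mul_kernel` (K2E3-p10).  `K` a field with `Valued K ℤᵐ⁰`, `σ` an involution preserving `v`, `ϖ` a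
uniformiser, `e : WittIndex r m ≃ Fin N` standard, `Han` `σ`-hermitian, integral, normalised (`|h_an(z,z)| ≤ 1 → z ∈ 𝒪^m` — ★ p856519 supplies such kernels in every
class at the unramified and tame places).  For every `g ∈ U(σ, wittFormOn e Han)` there are `k₁, k₂ ∈ U` integral with integral inverses and `d : Fin N → K`, `E : Fin N → ℤ`
with `k₁ g k₂ = diag(d)`, `σ(d_i) d_{rev i} = 1`, `d ≡ 1` on the kernel positions, `|d_k| = q^{−E_k}`, `E` antitone.  Every residue characteristic, ramified `σ` included.
[cite: BruhatTits1972, (4.4.3)] [cite: Tits1979, §3.3.3] [cite: Macdonald1995, Ch. V §2] [cite: Jacobowitz1962, §§7–10] -/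
theorem exists_cartan_witt (hσ : ∀ a, σ (σ a) = a) (hvσ : ∀ a, Valued.v (σ a) = Valued.v a) {ϖ : K} (hϖ : Valued.v ϖ = WithZero.exp (-1 : ℤ))
    (hHan : (Han.map σ)ᵀ = Han) (hint : ∀ u u', Valued.v (Han u u') ≤ 1) (hmax : ∀ z : Fin m → K, Valued.v (hermForm σ Han z z) ≤ 1 → z ∈ stdLattice K m)
    (g : GL (Fin N) K) (hg : g ∈ unitaryGroupOfForm σ (wittFormOn e Han)) :
    ∃ k₁ k₂ : GL (Fin N) K, k₁ ∈ unitaryGroupOfForm σ (wittFormOn e Han) ∧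
      (∀ i j, Valued.v ((k₁ : Matrix (Fin N) (Fin N) K) i j) ≤ 1) ∧ (∀ i j, Valued.v (((k₁⁻¹ : GL (Fin N) K) : Matrix (Fin N) (Fin N) K) i j) ≤ 1) ∧
      k₂ ∈ unitaryGroupOfForm σ (wittFormOn e Han) ∧
      (∀ i j, Valued.v ((k₂ : Matrix (Fin N) (Fin N) K) i j) ≤ 1) ∧ (∀ i j, Valued.v (((k₂⁻¹ : GL (Fin N) K) : Matrix (Fin N) (Fin N) K) i j) ≤ 1) ∧
      ∃ (d : Fin N → K) (E : Fin N → ℤ), ((k₁ * g * k₂ : GL (Fin N) K) : Matrix (Fin N) (Fin N) K) = Matrix.diagonal d ∧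
        (∀ i, σ (d i) * d (Fin.rev i) = 1) ∧ (∀ u : Fin m, d (e (Sum.inr (Sum.inl u))) = 1) ∧
        (∀ k, Valued.v (d k) = WithZero.exp (-E k)) ∧ (∀ i j : Fin N, i ≤ j → E j ≤ E i) := by
  set q : unitaryGroupOfForm σ (wittFormOn e Han) := ⟨g, hg⟩ with hq
  -- the initial bound `B = 1 ⊔ sup |entries of q, q⁻¹|`
  set B : ℤᵐ⁰ := 1 ⊔ Finset.univ.sup (fun ab : Fin N × Fin N => max (Valued.v (((q : GL (Fin N) K) : Matrix (Fin N) (Fin N) K) ab.1 ab.2))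
    (Valued.v ((((q : GL (Fin N) K)⁻¹ : GL (Fin N) K) : Matrix (Fin N) (Fin N) K) ab.1 ab.2))) with hB
  have hB1 : 1 ≤ B := le_sup_left
  have hle : ∀ a b : Fin N, Valued.v (((q : GL (Fin N) K) : Matrix (Fin N) (Fin N) K) a b) ≤ B ∧
      Valued.v ((((q : GL (Fin N) K)⁻¹ : GL (Fin N) K) : Matrix (Fin N) (Fin N) K) a b) ≤ B := fun a b => by
    have h := Finset.le_sup (f := fun ab : Fin N × Fin N => max (Valued.v (((q : GL (Fin N) K) : Matrix (Fin N) (Fin N) K) ab.1 ab.2))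
      (Valued.v ((((q : GL (Fin N) K)⁻¹ : GL (Fin N) K) : Matrix (Fin N) (Fin N) K) ab.1 ab.2))) (Finset.mem_univ (a, b))
    exact ⟨(le_max_left _ _).trans (h.trans le_sup_right), (le_max_right _ _).trans (h.trans le_sup_right)⟩
  have hS0 : ∀ a : Fin N, a ∈ (Finset.univ.filter fun a : Fin N => 0 ≤ a.val ∧ a.val + 0 < N) := fun a => by
    rw [mem_frameSet_iff]; exact ⟨Nat.zero_le _, by rw [add_zero]; exact a.isLt⟩
  obtain ⟨k₁, k₂, hk₁, hk₂, d, E, hdiag, htor, hker, hexp, hanti⟩ := exists_cartan_of_invariant σ e hstd Han hσ hvσ hϖ hHan hint hmax r 0 (zero_add r) B q hB1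
    (fun a ha => absurd (hS0 a) ha) (fun a ha => absurd ha (Nat.not_lt_zero _)) (fun a b ha => absurd ha (Nat.not_lt_zero _)) (fun a _ b _ => hle a b)
  refine ⟨(k₁ : GL (Fin N) K), (k₂ : GL (Fin N) K), k₁.2, (mem_unitaryInt_iff.1 hk₁).1, (mem_unitaryInt_iff.1 hk₁).2, k₂.2,
    (mem_unitaryInt_iff.1 hk₂).1, (mem_unitaryInt_iff.1 hk₂).2, d, E, ?_, htor, hker, hexp, hanti⟩
  rw [← hdiag, Subgroup.coe_mul, Subgroup.coe_mul]

end Main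

end Summit.HodgeConjecture.HodgeConjecture.Cruxes.H413.K2E3WittCartan

end
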